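import Mathlib
import HarnessLib
import Summits.RiemannHypothesis.RiemannHypothesis.Theses.SuzukiWindowsDoor
import Summits.RiemannHypothesis.RiemannHypothesis.Theorems.DeBrangesSuzukiDoorWitnessDetectsRH
import Summits.RiemannHypothesis.RiemannHypothesis.Theorems.SuzukiWindowsDoorKernelContinuous
import Summits.RiemannHypothesis.RiemannHypothesis.Theorems.SuzukiWindowsDoorContractionGivesWitness
import Summits.RiemannHypothesis.RiemannHypothesis.Theorems.SuzukiWindowsDoorWindowsImplyContraction

/-!
# RiemannHypothesis / SuzukiWindowsDoor — the rung leaf candidate `AllWindowsDetectRH` (stmt-RiemannHypothesis-19736) PROVED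

THE RUNG LEAF CANDIDATE B-P(P2) of route `route-RiemannHypothesis-SuzukiWindowsDoor`, hypothesis-free RH-FREE operator
door: for every `θ > 10`, if NO compression `𝖪_θ[t]`, `t ≥ 0`, of Suzuki's single operator has eigenvalue `±1`
(`Literature.NumberTheory.LFunctions.NoUnitEigenvalue K_θ t` for all `t ≥ 0`), then the Riemann Hypothesis holds.
Pure logic from the four landed RH-free items: `suzukiWindowsDoor_kernelContinuous_proof` (p411128),
`suzukiWindowsDoor_windowsImplyContraction_proof` (crux A1), `suzukiWindowsDoor_contractionGivesWitness_proof`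
(p411145) and the shared leaf `witnessDetectsRH_proof` (p410667; the two routes' `WitnessDetectsRH` constants are the
same proposition). An RH-FREE theorem about an RH-EQUIVALENT·DERIVED criterion (Suzuki's wished single-operator
condition); the converse direction is [Su21] Thm 2.1/Prop 4.4 (not formalised). Nothing here bears on the truth of RH.
-/

noncomputable section

-- D-0017: `Summit.<S>.<S>.…` is the designed namespace of a single-problem summit.
set_option linter.dupNamespace false

namespace Summit.RiemannHypothesis.RiemannHypothesis.Theorems

/-- **Route `SuzukiWindowsDoor`, rung leaf candidate `AllWindowsDetectRH` (stmt-RiemannHypothesis-19736) — PROVED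
(RH-FREE).** For every `θ > 10`: no unit eigenvalue of `𝖪_θ[t]` in any window `t ≥ 0` ⟹ RH. -/
theorem suzukiWindowsDoor_allWindowsDetectRH_proof :
    Summit.RiemannHypothesis.RiemannHypothesis.Theses.SuzukiWindowsDoor.AllWindowsDetectRH := by
  intro θ hθ Θ K hNo
  exact witnessDetectsRH_proof θ hθ
    (suzukiWindowsDoor_contractionGivesWitness_proof K
      (suzukiWindowsDoor_windowsImplyContraction_proof K (suzukiWindowsDoor_kernelContinuous_proof θ hθ) hNo))

end Summit.RiemannHypothesis.RiemannHypothesis.Theorems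

end
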